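import Literature.NumberTheory.LFunctions.WeilBlockRowsPZ
import Literature.NumberTheory.LFunctions.WeilFirstPrimeCertificate
import HarnessLib

/-!
# Two-prime certificates: the Bessel-block claim `Hp = C H Cᵀ` transfers between certificates sharing a `C` block

Topic `Literature/NumberTheory/LFunctions` (kernel certificates of the Weil form on windows, `WeilCert` format).  The claim
`Hp = C H Cᵀ` (`WeilCert.checkHpRow`) is the exact Legendre cancellation `C H Cᵀ = diag(2a₀/(2(2i+p)+1))`; its kernel check
costs ≈ 16k products of 170-digit rationals per row and is the single most expensive piece of a certificate.  But
`H_{kl} = 2a₀/((2k+p)+(2l+p)+1)` is LINEAR in the half-length `a₀` and the Legendre blocks `C` are shared between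
certificates (`weilCert23HC`, …): so the rows checked once for one certificate (e.g. `checkHpRows_weilCert23H`) give the
rows of every certificate with the same `C` block and `nb`, after rescaling `Hp` by `a₀'/a₀` — `WeilCert.checkHpRow_of_scaled`
(no kernel computation).  [folklore]
-/

noncomputable section

open Finset
open scoped BigOperators

namespace Literature.NumberTheory.LFunctions

namespace WeilCert

/-- The `C·H` row scales with `a₀` when the `C` block and `nb` agree. [folklore] -/
theorem getV_chRow_scaled {c c' : WeilCert} {p : ℕ} (hC : c'.Cb p = c.Cb p) (hnb : c'.nb = c.nb) (ha : c.a0 ≠ 0)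
    (i : ℕ) {l : ℕ} (hl : l < c.nb) :
    getV (c'.chRow p i) l = c'.a0 / c.a0 * getV (c.chRow p i) l := by
  unfold chRow
  rw [hnb, getV_tabV _ hl, getV_tabV _ hl, sumR_eq_sum, sumR_eq_sum, Finset.mul_sum]
  refine Finset.sum_congr rfl fun k _ ↦ ?_
  rw [hC]
  unfold hBlkQ
  field_simp

/-- **Transfer of the Bessel-block rows.**  If `c'` has the same `C` block (parity `p`) and the same `nb` as `c`, the
row `i` of `Hp = C H Cᵀ` is checked for `c`, and `Hp'` is `Hp` rescaled by `a₀'/a₀` on the row, then the row is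
checked for `c'`. [folklore] -/
theorem checkHpRow_of_scaled {c c' : WeilCert} {p : ℕ} (hC : c'.Cb p = c.Cb p) (hnb : c'.nb = c.nb) (ha : c.a0 ≠ 0)
    {Hp Hp' : List (List ℚ)} {i : ℕ} (h : c.checkHpRow Hp p i = true)
    (hHp' : ∀ j < c.nb, getM Hp' i j = c'.a0 / c.a0 * getM Hp i j) : c'.checkHpRow Hp' p i = true := by
  unfold checkHpRow
  rw [hnb]
  refine WeilCert2.allBelow_of_forall fun j hj ↦ ?_
  rw [decide_eq_true_eq, hHp' j hj, getM_Hp_of_checkHpRow h hj, sumR_eq_sum, sumR_eq_sum, Finset.mul_sum]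
  refine Finset.sum_congr rfl fun l hl ↦ ?_
  rw [getV_chRow_scaled hC hnb ha i (Finset.mem_range.1 hl), hC]
  ring

/-- The diagonal Bessel block `tabM n (2a/(4i+2p+1) δ_ij)` rescales with `a`. [folklore] -/
theorem getM_tabM_diag_scaled (n : ℕ) (a a' q : ℚ) (ha : a ≠ 0) {i j : ℕ} (hi : i < n) (hj : j < n) :
    getM (tabM n fun i j ↦ if i = j then 2 * a' / (4 * (i : ℚ) + q) else 0) i j =
      a' / a * getM (tabM n fun i j ↦ if i = j then 2 * a / (4 * (i : ℚ) + q) else 0) i j := by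
  rw [getM_tabM _ hi hj, getM_tabM _ hi hj]
  split_ifs
  · field_simp
  · ring

end WeilCert

end Literature.NumberTheory.LFunctions
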